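import Literature.MathematicalPhysics.KineticTheory.HardSphereEuler
import Literature.MathematicalPhysics.KineticTheory.Hilbert6Wave0
import Mathlib.Analysis.Calculus.FDeriv.Measurable
import HarnessLib

/-!
# EnskogAdjointDuality / DualityReduction — helper 7: measurability of the test-side Enskog
# operator and of the characteristic derivative

Support lemmas for `Summit.AtomisticToContinuum.HydrodynamicLimit.Theses.EnskogAdjointDuality.DualityReduction`
(stmt-AtomisticToContinuum-11590). To merge the free-streaming and collision parts of the
duality identity (`∫⟨μ_s, Dφ_s⟩ + ∫⟨μ_s, L_sφ_s⟩ = ∫⟨μ_s, (D+L)φ_s⟩`, and the same against the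
Euler local Maxwellian) one needs the integrands to be integrable, in particular measurable in
`(s, x, v)`. This file proves:

* `continuous_localMaxwellian_param` — joint continuity of `(θ, u, v) ↦ M_{1,θ,u}(v)` on `θ > 0`
  along continuous parameter maps;
* `measurable_enskogL_of_continuous` — the parametric double integral
  `(s, x, v) ↦ λ ∫_{S²} ∫ ((v−w)·ω)₊ Yf g M Δφ dw dσ(ω)` is measurable when all coefficient maps are
  continuous (continuity of the integrand, then `StronglyMeasurable.integral_prod_right'` twice);
* `measurable_charDeriv` — `(s, x, v) ↦ d/dr φ(r, x + (r−s)v, v)|_{r=s}` is measurable for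
  continuous `φ` (`measurable_deriv_with_param`), and `derivWithin_charDeriv_eq_deriv` — on the
  open window it is the route's `derivWithin … (Icc 0 t)`.

References: M. Pulvirenti, S. Simonella, arXiv:1504.03215, §2 [PulvirentiSimonella2016].
-/

noncomputable section

open MeasureTheory Set Filter Topology Function
open scoped ENNReal BigOperators InnerProductSpace

namespace Summit.AtomisticToContinuum.HydrodynamicLimit.Theorems

open Literature.Analysis.FluidPDE Literature.MathematicalPhysics.KineticTheory

/-! ## Joint continuity of the local Maxwellian -/

/-- Joint continuity of the local Maxwellian `M_{1, θ, u}(v)` in `(θ, u, v)` along continuous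
parameter maps with `θ > 0`. [folklore] -/
theorem continuous_localMaxwellian_param {X : Type*} [TopologicalSpace X] {θf : X → ℝ}
    {uf vf : X → V3} (hθ : Continuous θf) (hθpos : ∀ q, 0 < θf q) (hu : Continuous uf)
    (hv : Continuous vf) :
    Continuous fun q => localMaxwellian 1 (θf q) (uf q) (vf q) := by
  unfold localMaxwellian
  refine ((continuous_const.mul ((continuous_const.mul hθ).rpow_const fun q => ?_)).mul
    (Real.continuous_exp.comp ?_))
  · exact Or.inl (mul_pos (mul_pos two_pos Real.pi_pos) (hθpos q)).ne'
  · refine Continuous.div ?_ (continuous_const.mul hθ) fun q => ?_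
    · exact ((hv.sub hu).norm.pow 2).neg
    · have := hθpos q
      positivity

/-! ## Measurability of the test-side Enskog operator -/

/-- **Measurability of the test-side Enskog operator as a function of `(s, x, v)`** when its
coefficient maps are (jointly) continuous: the integrand is continuous in
`((s, x, v), ω, w)`, so the `w`-integral and then the `ω`-integral are strongly measurable in the
remaining variables (`StronglyMeasurable.integral_prod_right'`). [folklore] -/
theorem measurable_enskogL_of_continuous {Yf g θf : ℝ → T3 → ℝ} {uf : ℝ → T3 → V3}
    {φ : ℝ → T3 → V3 → ℝ} {xs ys : T3 → Metric.sphere (0 : V3) 1 → T3} {lam : ℝ}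
    (hYc : Continuous (uncurry Yf)) (hgc : Continuous (uncurry g))
    (hθc : Continuous (uncurry θf)) (hθpos : ∀ s x, 0 < θf s x) (huc : Continuous (uncurry uf))
    (hφc : Continuous fun p : ℝ × T3 × V3 => φ p.1 p.2.1 p.2.2)
    (hxs : Continuous (uncurry xs)) (hys : Continuous (uncurry ys))
    (L : ℝ → T3 → V3 → ℝ)
    (hL : ∀ s x v, L s x v = lam * ∫ ω : Metric.sphere (0 : V3) 1, (∫ w : V3,
      max ⟪v - w, (ω : V3)⟫_ℝ 0 * Yf s (xs x ω) *
        (g s (ys x ω) * localMaxwellian 1 (θf s (ys x ω)) (uf s (ys x ω)) w) *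
        (φ s x (v - ⟪v - w, (ω : V3)⟫_ℝ • (ω : V3)) + φ s (ys x ω) (w + ⟪v - w, (ω : V3)⟫_ℝ • (ω : V3)) -
          φ s x v - φ s (ys x ω) w)) ∂sphereMeasure) :
    Measurable fun p : ℝ × T3 × V3 => L p.1 p.2.1 p.2.2 := by
  haveI : IsFiniteMeasure (sphereMeasure : Measure (Metric.sphere (0 : V3) 1)) := by
    unfold sphereMeasure; infer_instance
  -- the integrand as a function of `((s, x, v), ω, w)`
  set B : ((ℝ × T3 × V3) × Metric.sphere (0 : V3) 1) × V3 → ℝ := fun q =>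
    max ⟪q.1.1.2.2 - q.2, (q.1.2 : V3)⟫_ℝ 0 * Yf q.1.1.1 (xs q.1.1.2.1 q.1.2) *
      (g q.1.1.1 (ys q.1.1.2.1 q.1.2) *
        localMaxwellian 1 (θf q.1.1.1 (ys q.1.1.2.1 q.1.2)) (uf q.1.1.1 (ys q.1.1.2.1 q.1.2)) q.2) *
      (φ q.1.1.1 q.1.1.2.1 (q.1.1.2.2 - ⟪q.1.1.2.2 - q.2, (q.1.2 : V3)⟫_ℝ • (q.1.2 : V3)) +
        φ q.1.1.1 (ys q.1.1.2.1 q.1.2) (q.2 + ⟪q.1.1.2.2 - q.2, (q.1.2 : V3)⟫_ℝ • (q.1.2 : V3)) -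
        φ q.1.1.1 q.1.1.2.1 q.1.1.2.2 - φ q.1.1.1 (ys q.1.1.2.1 q.1.2) q.2) with hBdef
  -- continuity of the building blocks
  have hs : Continuous fun q : ((ℝ × T3 × V3) × Metric.sphere (0 : V3) 1) × V3 => q.1.1.1 := by
    fun_prop
  have hx : Continuous fun q : ((ℝ × T3 × V3) × Metric.sphere (0 : V3) 1) × V3 => q.1.1.2.1 := by
    fun_prop
  have hv : Continuous fun q : ((ℝ × T3 × V3) × Metric.sphere (0 : V3) 1) × V3 => q.1.1.2.2 := by
    fun_prop
  have hw : Continuous fun q : ((ℝ × T3 × V3) × Metric.sphere (0 : V3) 1) × V3 => q.2 := by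
    fun_prop
  have hω : Continuous fun q : ((ℝ × T3 × V3) × Metric.sphere (0 : V3) 1) × V3 => (q.1.2 : V3) := by
    fun_prop
  have hωs : Continuous fun q : ((ℝ × T3 × V3) × Metric.sphere (0 : V3) 1) × V3 => q.1.2 := by
    fun_prop
  have hy : Continuous fun q : ((ℝ × T3 × V3) × Metric.sphere (0 : V3) 1) × V3 =>
      ys q.1.1.2.1 q.1.2 := hys.comp (hx.prodMk hωs)
  have hxω : Continuous fun q : ((ℝ × T3 × V3) × Metric.sphere (0 : V3) 1) × V3 =>
      xs q.1.1.2.1 q.1.2 := hxs.comp (hx.prodMk hωs)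
  have hin : Continuous fun q : ((ℝ × T3 × V3) × Metric.sphere (0 : V3) 1) × V3 =>
      ⟪q.1.1.2.2 - q.2, (q.1.2 : V3)⟫_ℝ := (hv.sub hw).inner hω
  have hφ' : ∀ {s' : ((ℝ × T3 × V3) × Metric.sphere (0 : V3) 1) × V3 → ℝ}
      {x' : ((ℝ × T3 × V3) × Metric.sphere (0 : V3) 1) × V3 → T3}
      {v' : ((ℝ × T3 × V3) × Metric.sphere (0 : V3) 1) × V3 → V3},
      Continuous s' → Continuous x' → Continuous v' → Continuous fun q => φ (s' q) (x' q) (v' q) :=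
    fun hs' hx' hv' => hφc.comp (hs'.prodMk (hx'.prodMk hv'))
  have hBc : Continuous B := by
    refine (((hin.max continuous_const).mul (hYc.comp (hs.prodMk hxω))).mul
      ((hgc.comp (hs.prodMk hy)).mul (continuous_localMaxwellian_param
        (hθc.comp (hs.prodMk hy)) (fun q => hθpos _ _) (huc.comp (hs.prodMk hy)) hw))).mul ?_
    exact (((hφ' hs hx (hv.sub (hin.smul hω))).add (hφ' hs hy (hw.add (hin.smul hω)))).sub
      (hφ' hs hx hv)).sub (hφ' hs hy hw)
  have hB : StronglyMeasurable B := hBc.stronglyMeasurable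
  have h1 : StronglyMeasurable fun q : (ℝ × T3 × V3) × Metric.sphere (0 : V3) 1 =>
      ∫ w : V3, B (q, w) := hB.integral_prod_right'
  have h2 : StronglyMeasurable fun p : ℝ × T3 × V3 =>
      ∫ ω, (fun q : (ℝ × T3 × V3) × Metric.sphere (0 : V3) 1 => ∫ w : V3, B (q, w)) (p, ω)
        ∂sphereMeasure := h1.integral_prod_right'
  have hfun : (fun p : ℝ × T3 × V3 => L p.1 p.2.1 p.2.2) = fun p =>
      lam * ∫ ω, (fun q : (ℝ × T3 × V3) × Metric.sphere (0 : V3) 1 => ∫ w : V3, B (q, w)) (p, ω)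
        ∂sphereMeasure := by
    funext p
    rw [hL]
  rw [hfun]
  exact h2.measurable.const_mul lam

/-! ## The characteristic derivative -/

/-- Measurability of the diagonal evaluation `p ↦ d/dr F(p, r)|_{r = p.1}` of the derivative of a
jointly continuous family (`measurable_deriv_with_param`). [folklore] -/
theorem measurable_deriv_diag {F : (ℝ × T3 × V3) → ℝ → ℝ} (hFc : Continuous F.uncurry) :
    Measurable fun p : ℝ × T3 × V3 => deriv (F p) p.1 :=
  (measurable_deriv_with_param hFc).comp (measurable_id.prodMk measurable_fst)

/-- **Measurability of the characteristic derivative.** For a jointly continuous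
`φ : ℝ → 𝕋³ → ℝ³ → ℝ`, the map `(s, x, v) ↦ d/dr φ(r, x + (r − s)v, v)|_{r = s}` (derivative
along the free-flight characteristic through `(s, x, v)`) is measurable
(`measurable_deriv_with_param`). [folklore] -/
theorem measurable_charDeriv {φ : ℝ → T3 → V3 → ℝ}
    (hφc : Continuous fun p : ℝ × T3 × V3 => φ p.1 p.2.1 p.2.2) :
    Measurable fun p : ℝ × T3 × V3 =>
      deriv (fun r => φ r ((Torus.geometry (Fin 3)).translate p.2.1 ((r - p.1) • p.2.2)) p.2.2)
        p.1 := by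
  have hFc : Continuous (Function.uncurry fun (p : ℝ × T3 × V3) (r : ℝ) =>
      φ r ((Torus.geometry (Fin 3)).translate p.2.1 ((r - p.1) • p.2.2)) p.2.2) := by
    have htr : Continuous fun q : (ℝ × T3 × V3) × ℝ =>
        (Torus.geometry (Fin 3)).translate q.1.2.1 ((q.2 - q.1.1) • q.1.2.2) := by
      simp only [Torus.geometry_translate]
      exact (continuous_fst.snd.fst).add (Literature.Analysis.FunctionSpaces.Torus.continuous_proj.comp
        ((continuous_snd.sub continuous_fst.fst).smul continuous_fst.snd.snd))
    exact hφc.comp (continuous_snd.prodMk (htr.prodMk continuous_fst.snd.snd))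
  exact measurable_deriv_diag hFc

/-- On the open window the route's one-sided derivative along the characteristic is the
two-sided one: for `s ∈ (0, t)`,
`derivWithin (r ↦ φ r (x + (r−s)v) v) [0, t] s = deriv (r ↦ φ r (x + (r−s)v) v) s`. [folklore] -/
theorem derivWithin_charDeriv_eq_deriv {φ : ℝ → T3 → V3 → ℝ} {t s : ℝ} (hs : s ∈ Ioo 0 t)
    (x : T3) (v : V3) :
    derivWithin (fun r => φ r ((Torus.geometry (Fin 3)).translate x ((r - s) • v)) v) (Icc 0 t) s =
      deriv (fun r => φ r ((Torus.geometry (Fin 3)).translate x ((r - s) • v)) v) s :=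
  derivWithin_of_mem_nhds (Icc_mem_nhds hs.1 hs.2)

end Summit.AtomisticToContinuum.HydrodynamicLimit.Theorems

end
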